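import Summits.QuantumFields.BalabanUV.T4Continuum.Support.ShellMeasureLinearizedFromQ
import Summits.QuantumFields.BalabanUV.T4Continuum.Support.ShellMeasureAverageDerivative

/-!
# `T4Continuum.ShellMeasureLinearizedGammaT` — NE7c-S52 file 1∕2, THE ASSEMBLY (core): (LR)_j REAL-FORM CHART DATA
# FOR THE PRINTED BLOCK AVERAGE [B7] (15) — the objects at a coarse bond (chart average `QtΓ`, p. 267's `hopΓ`, the
# conjugations `⋆`) and row S46's END FIRED for them modulo the three ball facts (Q1) (Q3) (Q4) and the fibre
# ⋆-equivariance, which file 2 (`ShellMeasureLinearizedGammaTEnd`) discharges from print's hypotheses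
(cell `pub-balaban`, sub-cell `t4`, spine estimate NE7c (node U5b); NE7c ROUND-2 crew `t4-ne7c-formalise-*`, seat
`b2b-balaban-t4-ne7c-formalise-leaf-08` gen 10; owner table `t4/b2b-balaban-t4-ne7c-p1/LEAVES-NE7c-P1.md` v2.2 ROW S52
«(LR)_j REAL-FORM CHART DATA FOR [B7] (15) FROM PRINT'S HYPOTHESES ALONE — THE ASSEMBLY», BOOKED → leaf-08-g10 «GO;
files last»; imports S46 `ShellMeasureLinearizedFromQ` (p218633; hence S40∕S36∕S33 f2 and the B12 leaves) and S48 f1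
`ShellMeasureAverageDerivative` (p218984; hence `B12AverageCorridor267`) ONLY, all BY NAME; [folklore]; data = eight
`abbrev`s (`QtΓ`, `hopΓ`, `κ𝔸`, `κΓ`, `TΓ`, `hΓ`, `winΓ`, `DtΓℝ` — reducible names for terms of the tree, no new notion),
0 `def … : Prop`, 0 sorry, 0 citations — «p. 267», «(15)» LOCATE displayed shapes)

HONEST FRAMING.  Finite four-torus programme, rung (B)+1 only — NOT infinite volume, NOT a mass gap, NOT the Clay
problem, NOT summit progress; (B), `BetaPertHyp`, (B^μ) not consumed.  NE7c (`T4IndicatorShell.ShellWeightBound`) is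
NOT PRINTED and NOT PROVED; «NE7c ⇐ the named binders» (trigger c3).  Nothing of [Balaban 1983–89] is asserted: the
printed block average (2.4)∕[Balaban1985Averaging] (15) and p. 267's operator `h` enter ONLY as the tree's typed
objects `B12AverageCorridor267.Qtilde ∕ gammaT ∕ hGen` (corner cubes on `ℤᵈ`, DIVERGENCE D-b12g20.1), and every fact
about them is a tree theorem used BY NAME (rows S46–S51).  What the two files DISCHARGE is the ANALYTIC half of WALL
§3 W-d for the PRINTED average about a unit-bounded, unitary, ε-regular background; what REMAINS of W-d is the [dict]
identification of a live slot's fibre with the fibre of this average about the step's background (node O) — and the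
whole of W-a∕W-b∕W-c∕W-e.  NOTHING in the countdown moves; spine PROVED 0/9.  HONEST DEPENDENCY (cell, verbatim):
continuum YM on T⁴ ⇐ BetaPertH ∧ nine spine estimates (0/9 proved); BetaPertH ⇐ (D1) ∧ (D4) ∧ CAP+tail; G-an2-4
gates asym, D1 and NE2/3/4.

THE POINT.  Row S46 (`ShellMeasureLinearizedFromQ.exists_realForm_chartData_of_Q`) turns FOUR hypotheses on one
analytic average `Qt` — (Q1) analytic on `ball 0 R`, (Q2) `Qt 0 = 0`, (Q3) `‖Qt‖ ≤ M_Q`, (Q4) `Qt ∘ κ_𝒴 = κ_𝒳 ∘ Qt` —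
plus a bounded equivariant right inverse `hop` of `DQ̃(0)` into S40's real chart data.  For the PRINTED average the
four hypotheses and `hop` are THEOREMS of rows S47–S51.  THIS FILE fixes the objects and fires S46:
* §1 the chart near a coarse bond `c`: bond functions on `B(c₋) ∪ B(c₊)` (`↥(qppBonds L c) → 𝔸`, sup norm) extended by
  zero (S49 f2's chart variable), its ⋆∕smul∕restriction bookkeeping.
* §2 `QtΓ L V c B := Q̃_V(ext B)(c)` for the contour family `gammaT` ([B7] (15) verbatim), `QtΓ_zero` ((Q2));
  `hopΓ := hopC (restriction) …` — p. 267's `h` as S46's `ℂ`-linear `hop` (row S48 `hopC`, hypotheses EXACTLY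
  `h_paragraph_p267_gammaT`'s), with `norm_hopΓ_le` (S46's `hHop`, clause (iii)), `fderiv_hopΓ` (S46's `hLQh`, row S48
  `apply_hopC`), `hopΓ_star` (S46's `hhop` ⇐ the fibre identity `hGen c (X⋆) = (hGen c X)⋆`, row S50 f2's theorem);
  the conjugations `κ𝔸 := starₗᵢ ℂ`, `κΓ := starₗᵢ ℂ` (componentwise; real form = HERMITIAN bond functions, S47 §5).
* §3 `exists_splitting_gammaT` (the real splitting `Ψ` of `DQ̃(0)`'s real form — S33 f2 `exists_splitting_of_rightInverse`
  + S36 `realForm_rightInverse`; row S50 f1's `kerSplit` is the constructed form), `window_ok` (the window numerics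
  `9·(Mq R 1)·b·εw < 1`, `3εw ≤ R` hold for `εw := R²∕(18b + 3R + 1)`), and the CORE **`realForm_chartData_gammaT_of`**:
  S46's END FIRED at `(QtΓ, hopΓ, κΓ, κ𝔸)` GIVEN (Q1), (Q3), (Q4) on a ball and the fibre ⋆-identity — conclusion
  LITERALLY S46's (∃ `D̃` in the ball solving print's fixed-point equation for `C̃ := Q̃ − DQ̃(0)`, `Q̃(B − hop D̃(B)) =
  DQ̃(0)B`, and S40's FOUR real-chart clauses on the Hermitian window); §3b readable names `TΓ`, `hΓ`, `winΓ`, `DtΓℝ`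
  for the real-form objects (file 2 states THE END with them and gives the `rfl` bridge).  File 2 supplies (Q1)(Q3)
  from S49 f2, (Q4) from S51 ∘ S47, the fibre identity from S50 f2, and states THE END with print's hypotheses only.
-/

noncomputable section

open Set Metric Filter Topology

namespace Summit.QuantumFields.BalabanUV.T4Continuum.ShellMeasureLinearizedGammaT

open Literature.MathematicalPhysics.QuantumFieldTheory.Balaban1983to89
open Literature.MathematicalPhysics.QuantumLattice (ZdEdge blockSites)
open B7BlockGeometry (qppBonds)
open B13CorridorSeparation (b0Z b0Z_mem_qppBonds)
open B12HOperator267 (gammaT)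
open B12AverageCorridor267 (Qtilde pert pert_zero loopW avgM Ustr expU offAxis isBlockLocal_gammaT
  isAxisStraightFamily_gammaT hGen)
open Summit.QuantumFields.BalabanUV.Beta.LinearizingChange267FromQ (nonlin Mq)
open ShellMeasureLinearizedRealStructure (realSub incl reP incl_reP_of_fixed conj_incl reP_incl)
open ShellMeasureLinearizedRealForm (realForm_rightInverse)
open ShellMeasureLinearizedConstraint (exists_splitting_of_rightInverse)
open ShellMeasureLinearizedFromQ (exists_realForm_chartData_of_Q)
open ShellMeasureAverageDerivative (hopC hopC_apply apply_hopC norm_hopC_le hop_bound_nonneg)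

/-! ## §1 The chart near a coarse bond: bond functions on `B(c₋) ∪ B(c₊)` extended by zero; restriction; ⋆ -/

section Pieces

variable {d : ℕ} {𝔸 : Type*} {L : ℕ} {c : ZdEdge d}

/-- extension by zero commutes with the componentwise `⋆` (`0⋆ = 0`). [folklore] -/
theorem extend_star [AddMonoid 𝔸] [StarAddMonoid 𝔸] (B : ↥(qppBonds L c) → 𝔸) :
    Function.extend Subtype.val (star B) (0 : ZdEdge d → 𝔸)
      = fun b => star (Function.extend Subtype.val B (0 : ZdEdge d → 𝔸) b) := by
  funext b
  by_cases hb : ∃ i : ↥(qppBonds L c), (i : ZdEdge d) = b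
  · obtain ⟨i, rfl⟩ := hb
    rw [Subtype.val_injective.extend_apply, Subtype.val_injective.extend_apply, Pi.star_apply]
  · rw [Function.extend_apply' _ _ _ hb, Function.extend_apply' _ _ _ hb, Pi.zero_apply, star_zero]

/-- extension by zero is `ℂ`-homogeneous. [folklore] -/
theorem extend_smul [AddCommMonoid 𝔸] [Module ℂ 𝔸] (s : ℂ) (B : ↥(qppBonds L c) → 𝔸) :
    Function.extend Subtype.val (s • B) (0 : ZdEdge d → 𝔸) = s • Function.extend Subtype.val B (0 : ZdEdge d → 𝔸) := by
  funext b
  by_cases hb : ∃ i : ↥(qppBonds L c), (i : ZdEdge d) = b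
  · obtain ⟨i, rfl⟩ := hb
    rw [Subtype.val_injective.extend_apply, Pi.smul_apply, Pi.smul_apply, Subtype.val_injective.extend_apply]
  · rw [Function.extend_apply' _ _ _ hb, Pi.smul_apply, Function.extend_apply' _ _ _ hb, Pi.zero_apply, smul_zero]

/-- the extension by zero of the restriction agrees with the field on the two blocks. [folklore] -/
theorem extend_restrict_apply [Zero 𝔸] (B' : ZdEdge d → 𝔸) {b : ZdEdge d} (hb : b ∈ qppBonds L c) :
    Function.extend Subtype.val (fun i : ↥(qppBonds L c) => B' i) (0 : ZdEdge d → 𝔸) b = B' b := by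
  have h : ((⟨b, hb⟩ : ↥(qppBonds L c)) : ZdEdge d) = b := rfl
  rw [← h, Subtype.val_injective.extend_apply]

/-- extension by zero of the zero bond function is the zero field. [folklore] -/
theorem extend_zero' [Zero 𝔸] : Function.extend Subtype.val (0 : ↥(qppBonds L c) → 𝔸) (0 : ZdEdge d → 𝔸) = 0 := by
  funext b
  by_cases hb : ∃ i : ↥(qppBonds L c), (i : ZdEdge d) = b
  · obtain ⟨i, rfl⟩ := hb
    rw [Subtype.val_injective.extend_apply, Pi.zero_apply, Pi.zero_apply]
  · rw [Function.extend_apply' _ _ _ hb]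

/-- the restriction of a one-bond field has sup norm at most the bond value's. [folklore] -/
theorem norm_restrict_single_le [NormedAddCommGroup 𝔸] (Y : 𝔸) :
    ‖(fun i : ↥(qppBonds L c) => (Pi.single (b0Z L c) Y : ZdEdge d → 𝔸) i)‖ ≤ ‖Y‖ := by
  refine (pi_norm_le_iff_of_nonneg (norm_nonneg Y)).2 fun i => ?_
  by_cases h : (i : ZdEdge d) = b0Z L c
  · rw [h, Pi.single_eq_same]
  · rw [Pi.single_eq_of_ne h, norm_zero]; exact norm_nonneg Y

/-- a one-bond field of a ⋆ed value is the ⋆ of the one-bond field. [folklore] -/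
theorem single_star [AddMonoid 𝔸] [StarAddMonoid 𝔸] (b : ZdEdge d) (Y : 𝔸) :
    (Pi.single b (star Y) : ZdEdge d → 𝔸) = star (Pi.single b Y : ZdEdge d → 𝔸) := by
  funext b'
  by_cases h : b' = b
  · subst h; rw [Pi.star_apply, Pi.single_eq_same, Pi.single_eq_same]
  · rw [Pi.star_apply, Pi.single_eq_of_ne h, Pi.single_eq_of_ne h, star_zero]

end Pieces

/-! ## §2 The objects of the assembly at a coarse bond: the chart average, p. 267's `hop`, the conjugations -/

variable {d : ℕ} {𝔸 : Type*} [NormedRing 𝔸] [NormedAlgebra ℂ 𝔸] [CompleteSpace 𝔸] [NormOneClass 𝔸]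

omit [NormOneClass 𝔸] in
/-- THE PRINTED AVERAGE IN THE CHART at the coarse bond `c`: `Qt B := Q̃_V(ext B)(c)` for [B7] (15)'s contour family
`gammaT` (S49 f2's `Qt`, verbatim). [folklore] -/
abbrev QtΓ (L : ℕ) (V : ZdEdge d → 𝔸ˣ) (c : ZdEdge d) : (↥(qppBonds L c) → 𝔸) → 𝔸 := fun B =>
  Qtilde L (fun U : ZdEdge d → 𝔸ˣ => gammaT L U) V (Function.extend Subtype.val B (0 : ZdEdge d → 𝔸)) c

omit [NormOneClass 𝔸] in
/-- (Q2): `Qt 0 = 0`. [folklore] -/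
theorem QtΓ_zero (L : ℕ) (V : ZdEdge d → 𝔸ˣ) (c : ZdEdge d) : QtΓ L V c 0 = 0 := by
  show Qtilde L _ V _ c = 0
  rw [extend_zero']
  unfold Qtilde
  rw [pert_zero, mul_inv_cancel, Units.val_one, MatrixLog.mlog_one, smul_zero]

section Hop

variable {L : ℕ} (hL : 0 < L) (V : ZdEdge d → 𝔸ˣ) {ε : ℝ} (hε0 : 0 ≤ ε) (hε : ε ≤ 1 / 8)
  (hW : ∀ c', ∀ x ∈ offAxis L c', ‖((loopW L (fun U : ZdEdge d → 𝔸ˣ => gammaT L U) V c' x : 𝔸ˣ) : 𝔸) - 1‖ ≤ ε)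
  (hV : ∀ b, ‖((V b : 𝔸ˣ) : 𝔸)‖ ≤ 1) (hV' : ∀ b, ‖(((V b)⁻¹ : 𝔸ˣ) : 𝔸)‖ ≤ 1)
  (hbud : (L : ℝ) ^ d / L * (24 * ε) < 1)

/-- **S46's `hop` FOR [B7] (15)**: p. 267's corridor operator read in the chart of the two blocks —
`X ↦ (δ_{b₀(c)}·h(c)X)|_{B(c₋)∪B(c₊)}`, row S48's `ℂ`-linear `hopC` at the restriction chart (hypotheses = those of
`h_paragraph_p267_gammaT`). [folklore] -/
abbrev hopΓ (c : ZdEdge d) : 𝔸 →ₗ[ℂ] (↥(qppBonds L c) → 𝔸) :=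
  hopC (fun (B' : ZdEdge d → 𝔸) (i : ↥(qppBonds L c)) => B' i) (fun _ _ => rfl) (fun _ _ => rfl) hL
    (isBlockLocal_gammaT hL) (isAxisStraightFamily_gammaT hL) V hε0 hε hW hV hV' hbud c

/-- `hopΓ X = (δ_{b₀(c)} (h(c) X))|_{qpp}`. [folklore] -/
theorem hopΓ_apply (c : ZdEdge d) (X : 𝔸) :
    hopΓ hL V hε0 hε hW hV hV' hbud c X = fun i : ↥(qppBonds L c) =>
      (Pi.single (b0Z L c) (hGen hL (isAxisStraightFamily_gammaT hL) V hε0 hε hW hV hV' hbud c X) : ZdEdge d → 𝔸) i :=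
  rfl

/-- **S46's `hHop`**: `‖hopΓ X‖ ≤ (Lᵈ∕L)∕(1 − (Lᵈ∕L)·24ε)·‖X‖` (clause (iii) of `h_paragraph_p267_gammaT`). [folklore] -/
theorem norm_hopΓ_le (c : ZdEdge d) (X : 𝔸) :
    ‖hopΓ hL V hε0 hε hW hV hV' hbud c X‖ ≤ ((L : ℝ) ^ d / L) / (1 - (L : ℝ) ^ d / L * (24 * ε)) * ‖X‖ :=
  norm_hopC_le _ (fun _ _ => rfl) (fun _ _ => rfl) hL (isBlockLocal_gammaT hL) (isAxisStraightFamily_gammaT hL) V hε0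
    hε hW hV hV' hbud c norm_restrict_single_le X

/-- **S46's `hLQh`**: `DQ̃(0) (hopΓ X) = X` — «LQ̃h = I» read through the Fréchet derivative (row S48's `apply_hopC`),
for any Fréchet derivative of the chart average at `0` (S49 f2 supplies it). [folklore] -/
theorem fderiv_hopΓ (c : ZdEdge d) {A : (↥(qppBonds L c) → 𝔸) →L[ℂ] 𝔸} (hF : HasFDerivAt (QtΓ L V c) A 0) (X : 𝔸) :
    A (hopΓ hL V hε0 hε hW hV hV' hbud c X) = X :=
  apply_hopC (fun B : ↥(qppBonds L c) → 𝔸 => Function.extend Subtype.val B (0 : ZdEdge d → 𝔸))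
    (fun (B' : ZdEdge d → 𝔸) (i : ↥(qppBonds L c)) => B' i) (fun s v => extend_smul s v) (fun _ _ => rfl)
    (fun _ _ => rfl) hL (isBlockLocal_gammaT hL) (isAxisStraightFamily_gammaT hL) V hε0 hε hW hV hV' hbud c
    (fun B' _ hb => extend_restrict_apply B' hb) (fun _ => rfl) hF X

end Hop

section Star

variable (𝔸) [StarRing 𝔸] [CStarRing 𝔸] [StarModule ℂ 𝔸]

omit [CompleteSpace 𝔸] [NormOneClass 𝔸] in
/-- the conjugation `⋆` on `𝔸` as a conjugate-linear isometric equivalence (Mathlib `starₗᵢ`) — S46's `κ_𝒳`. [folklore] -/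
abbrev κ𝔸 : 𝔸 ≃ₗᵢ⋆[ℂ] 𝔸 := starₗᵢ ℂ

omit [CompleteSpace 𝔸] [NormOneClass 𝔸] in
/-- the componentwise conjugation on the bond functions of `B(c₋) ∪ B(c₊)` — S46's `κ_𝒴`; its real form is the set
of HERMITIAN bond functions (S47 `mem_realSub_pi_star_iff`). [folklore] -/
abbrev κΓ (L : ℕ) (c : ZdEdge d) : (↥(qppBonds L c) → 𝔸) ≃ₗᵢ⋆[ℂ] (↥(qppBonds L c) → 𝔸) := starₗᵢ ℂ

variable {𝔸}

omit [CompleteSpace 𝔸] [NormOneClass 𝔸] in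
/-- `κ_𝒳` is involutive. [folklore] -/
theorem κ𝔸_invol (X : 𝔸) : κ𝔸 𝔸 (κ𝔸 𝔸 X) = X := star_star X

omit [CompleteSpace 𝔸] [NormOneClass 𝔸] in
/-- `κ_𝒴` is involutive. [folklore] -/
theorem κΓ_invol {L : ℕ} {c : ZdEdge d} (B : ↥(qppBonds L c) → 𝔸) : κΓ 𝔸 L c (κΓ 𝔸 L c B) = B := star_star B

variable {L : ℕ} (hL : 0 < L) (V : ZdEdge d → 𝔸ˣ) {ε : ℝ} (hε0 : 0 ≤ ε) (hε : ε ≤ 1 / 8)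
  (hW : ∀ c', ∀ x ∈ offAxis L c', ‖((loopW L (fun U : ZdEdge d → 𝔸ˣ => gammaT L U) V c' x : 𝔸ˣ) : 𝔸) - 1‖ ≤ ε)
  (hV : ∀ b, ‖((V b : 𝔸ˣ) : 𝔸)‖ ≤ 1) (hV' : ∀ b, ‖(((V b)⁻¹ : 𝔸ˣ) : 𝔸)‖ ≤ 1)
  (hbud : (L : ℝ) ^ d / L * (24 * ε) < 1)

/-- **S46's `hhop` FROM THE FIBRE MAP's ⋆-EQUIVARIANCE** (row S50 f2 supplies `hGen c (X⋆) = (hGen c X)⋆`):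
`hopΓ (X⋆) = (hopΓ X)⋆`. [folklore] -/
theorem hopΓ_star (c : ZdEdge d)
    (hhop0 : ∀ X, hGen hL (isAxisStraightFamily_gammaT hL) V hε0 hε hW hV hV' hbud c (star X)
      = star (hGen hL (isAxisStraightFamily_gammaT hL) V hε0 hε hW hV hV' hbud c X)) (X : 𝔸) :
    hopΓ hL V hε0 hε hW hV hV' hbud c (κ𝔸 𝔸 X) = κΓ 𝔸 L c (hopΓ hL V hε0 hε hW hV hV' hbud c X) := by
  rw [starₗᵢ_apply, starₗᵢ_apply, hopΓ_apply, hopΓ_apply, hhop0, single_star]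
  rfl

end Star

/-! ## §3 THE ASSEMBLY (core form) -/

section Assembly

variable [StarRing 𝔸] [CStarRing 𝔸] [StarModule ℂ 𝔸] {L : ℕ} {c : ZdEdge d}

/-- **THE SPLITTING EXISTS** (S33 f2 `exists_splitting_of_rightInverse` + S36 `realForm_rightInverse`; row S50 f1's
`kerSplit` is the constructed form): a real splitting `Ψ : ker T × Fix(⋆_𝔸) ≃ Fix(⋆)` with `(Ψ.symm y).2 = T y`,
`T := reP ∘ DQ̃(0)↾ℝ ∘ incl` the real form of `LQ̃`. [folklore] -/
theorem exists_splitting_gammaT (hL : 0 < L) {V : ZdEdge d → 𝔸ˣ}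
    (hV : ∀ b, ‖((V b : 𝔸ˣ) : 𝔸)‖ ≤ 1) (hV' : ∀ b, ‖(((V b)⁻¹ : 𝔸ˣ) : 𝔸)‖ ≤ 1) {ε : ℝ} (hε0 : 0 ≤ ε) (hε : ε ≤ 1 / 8)
    (hW : ∀ c', ∀ x ∈ offAxis L c', ‖((loopW L (fun U : ZdEdge d → 𝔸ˣ => gammaT L U) V c' x : 𝔸ˣ) : 𝔸) - 1‖ ≤ ε)
    (hbud : (L : ℝ) ^ d / L * (24 * ε) < 1) {R : ℝ} (hR : 0 < R)
    (hQa : AnalyticOnNhd ℂ (QtΓ L V c) (ball 0 R))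
    (hhop0 : ∀ X, hGen hL (isAxisStraightFamily_gammaT hL) V hε0 hε hW hV hV' hbud c (star X)
      = star (hGen hL (isAxisStraightFamily_gammaT hL) V hε0 hε hW hV hV' hbud c X)) :
    ∃ Ψ : (LinearMap.ker ((reP (κ𝔸 𝔸) κ𝔸_invol ∘L (fderiv ℂ (QtΓ L V c) 0).restrictScalars ℝ ∘L
          incl (κΓ 𝔸 L c) : realSub (κΓ 𝔸 L c) →L[ℝ] realSub (κ𝔸 𝔸)) :
            realSub (κΓ 𝔸 L c) →ₗ[ℝ] realSub (κ𝔸 𝔸)) × realSub (κ𝔸 𝔸)) ≃L[ℝ] realSub (κΓ 𝔸 L c),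
      ∀ y, (Ψ.symm y).2 = (reP (κ𝔸 𝔸) κ𝔸_invol ∘L (fderiv ℂ (QtΓ L V c) 0).restrictScalars ℝ ∘L
        incl (κΓ 𝔸 L c)) y := by
  have hF : HasFDerivAt (QtΓ L V c) (fderiv ℂ (QtΓ L V c) 0) 0 :=
    (hQa 0 (mem_ball_self hR)).differentiableAt.hasFDerivAt
  obtain ⟨Ψ, -, hΨ⟩ := exists_splitting_of_rightInverse
    (reP (κ𝔸 𝔸) κ𝔸_invol ∘L (fderiv ℂ (QtΓ L V c) 0).restrictScalars ℝ ∘L incl (κΓ 𝔸 L c))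
    (reP (κΓ 𝔸 L c) κΓ_invol ∘L ((hopΓ hL V hε0 hε hW hV hV' hbud c).mkContinuous _
      (norm_hopΓ_le hL V hε0 hε hW hV hV' hbud c)).restrictScalars ℝ ∘L incl (κ𝔸 𝔸))
    (realForm_rightInverse (fderiv ℂ (QtΓ L V c) 0) (fderiv_hopΓ hL V hε0 hε hW hV hV' hbud c hF)
      (norm_hopΓ_le hL V hε0 hε hW hV hV' hbud c) (hopΓ_star hL V hε0 hε hW hV hV' hbud c hhop0)
      (incl_reP_of_fixed κΓ_invol) (conj_incl (κ𝔸 𝔸)) (reP_incl κ𝔸_invol))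
  exact ⟨Ψ, hΨ⟩


/-- **THE WINDOW NUMERICS ARE SATISFIABLE, EXPLICITLY**: for `R > 0`, `b ≥ 0` the radius `εw := R²∕(18b + 3R + 1)`
satisfies `9·(Mq R 1)·b·εw < 1` and `3εw ≤ R` (`Mq R 1 = 2∕R²`). [folklore] -/
theorem window_ok {R b : ℝ} (hR : 0 < R) (hb : 0 ≤ b) :
    9 * Mq R 1 * b * (R ^ 2 / (18 * b + 3 * R + 1)) < 1 ∧ 3 * (R ^ 2 / (18 * b + 3 * R + 1)) ≤ R := by
  have hD : 0 < 18 * b + 3 * R + 1 := by positivity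
  have hR2 : 0 < R ^ 2 := by positivity
  constructor
  · unfold Mq
    rw [show 9 * (2 * (1 : ℝ) / R ^ 2) * b * (R ^ 2 / (18 * b + 3 * R + 1)) = 18 * b / (18 * b + 3 * R + 1) by
      field_simp; ring]
    rw [div_lt_one hD]
    linarith
  · rw [show 3 * (R ^ 2 / (18 * b + 3 * R + 1)) = R * (3 * R / (18 * b + 3 * R + 1)) by ring]
    have h1 : 3 * R / (18 * b + 3 * R + 1) ≤ 1 := by
      rw [div_le_one hD]; linarith
    calc R * (3 * R / (18 * b + 3 * R + 1)) ≤ R * 1 := mul_le_mul_of_nonneg_left h1 hR.le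
      _ = R := mul_one R

variable [FiniteDimensional ℂ 𝔸] [MeasurableSpace 𝔸] [BorelSpace 𝔸] [MeasurableSpace (↥(qppBonds L c) → 𝔸)]
  [BorelSpace (↥(qppBonds L c) → 𝔸)]

/-- **NE7c-S52 CORE.** For the printed average `QtΓ L V c` and p. 267's `hopΓ` (hypotheses EXACTLY
`h_paragraph_p267_gammaT`'s: `hL hV hV' hε0 hε hW hbud`), GIVEN (Q1) analyticity and (Q3) a bound `M_Q` on `ball 0 R`,
(Q4) ⋆-equivariance on that ball (row S51) and the fibre ⋆-equivariance `hGen c (X⋆) = (hGen c X)⋆` (row S50 f2), and a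
window radius `εw` with `9·Mq R M_Q·b·εw < 1`, `3εw ≤ R`: S46's `exists_realForm_chartData_of_Q` FIRES — `D̃` in the
ball, print's fixed-point equation for `C̃ := nonlin Qt`, `Q̃(B − hop (D̃ B)) = DQ̃(0) B`, and S40's FOUR real-chart
clauses on the Hermitian window, for any real splitting `Ψ` of `DQ̃(0)`'s real form. [folklore] -/
theorem realForm_chartData_gammaT_of (hL : 0 < L) {V : ZdEdge d → 𝔸ˣ}
    (hV : ∀ b, ‖((V b : 𝔸ˣ) : 𝔸)‖ ≤ 1) (hV' : ∀ b, ‖(((V b)⁻¹ : 𝔸ˣ) : 𝔸)‖ ≤ 1) {ε : ℝ} (hε0 : 0 ≤ ε) (hε : ε ≤ 1 / 8)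
    (hW : ∀ c', ∀ x ∈ offAxis L c', ‖((loopW L (fun U : ZdEdge d → 𝔸ˣ => gammaT L U) V c' x : 𝔸ˣ) : 𝔸) - 1‖ ≤ ε)
    (hbud : (L : ℝ) ^ d / L * (24 * ε) < 1) {R MQ εw : ℝ} (hR : 0 < R)
    (hQa : AnalyticOnNhd ℂ (QtΓ L V c) (ball 0 R))
    (hQM : ∀ B ∈ ball (0 : ↥(qppBonds L c) → 𝔸) R, ‖QtΓ L V c B‖ ≤ MQ)
    (hQt : ∀ B ∈ ball (0 : ↥(qppBonds L c) → 𝔸) R, QtΓ L V c (κΓ 𝔸 L c B) = κ𝔸 𝔸 (QtΓ L V c B))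
    (hhop0 : ∀ X, hGen hL (isAxisStraightFamily_gammaT hL) V hε0 hε hW hV hV' hbud c (star X)
      = star (hGen hL (isAxisStraightFamily_gammaT hL) V hε0 hε hW hV hV' hbud c X))
    (hq : 9 * Mq R MQ * (((L : ℝ) ^ d / L) / (1 - (L : ℝ) ^ d / L * (24 * ε))) * εw < 1) (hRC : 3 * εw ≤ R)
    {Kf : Type*} [NormedAddCommGroup Kf] [NormedSpace ℝ Kf] (Ψ : (Kf × realSub (κ𝔸 𝔸)) ≃L[ℝ] realSub (κΓ 𝔸 L c))
    (hΨ : ∀ y, (Ψ.symm y).2 = (reP (κ𝔸 𝔸) κ𝔸_invol ∘L (fderiv ℂ (QtΓ L V c) 0).restrictScalars ℝ ∘L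
      incl (κΓ 𝔸 L c)) y) :
    ∃ Dt : (↥(qppBonds L c) → 𝔸) → 𝔸,
      (∀ B : ↥(qppBonds L c) → 𝔸, ‖B‖ < εw → Dt B ∈ closedBall (0 : 𝔸) (4 * Mq R MQ * εw ^ 2) ∧
        nonlin (QtΓ L V c) (B - hopΓ hL V hε0 hε hW hV hV' hbud c (Dt B)) = Dt B ∧
        QtΓ L V c (B - hopΓ hL V hε0 hε hW hV hV' hbud c (Dt B)) = fderiv ℂ (QtΓ L V c) 0 B) ∧
      Measurable (fun B : realSub (κΓ 𝔸 L c) => B - (reP (κΓ 𝔸 L c) κΓ_invol ∘L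
          ((hopΓ hL V hε0 hε hW hV hV' hbud c).mkContinuous _ (norm_hopΓ_le hL V hε0 hε hW hV hV' hbud c)).restrictScalars ℝ
          ∘L incl (κ𝔸 𝔸)) (({y : realSub (κΓ 𝔸 L c) | ‖incl (κΓ 𝔸 L c) y‖ < εw}).piecewise
            (fun y => reP (κ𝔸 𝔸) κ𝔸_invol (Dt (incl (κΓ 𝔸 L c) y))) 0 B)) ∧
      InjOn (fun B : realSub (κΓ 𝔸 L c) => B - (reP (κΓ 𝔸 L c) κΓ_invol ∘L
          ((hopΓ hL V hε0 hε hW hV hV' hbud c).mkContinuous _ (norm_hopΓ_le hL V hε0 hε hW hV hV' hbud c)).restrictScalars ℝ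
          ∘L incl (κ𝔸 𝔸)) (({y : realSub (κΓ 𝔸 L c) | ‖incl (κΓ 𝔸 L c) y‖ < εw}).piecewise
            (fun y => reP (κ𝔸 𝔸) κ𝔸_invol (Dt (incl (κΓ 𝔸 L c) y))) 0 B))
          {y : realSub (κΓ 𝔸 L c) | ‖incl (κΓ 𝔸 L c) y‖ < εw} ∧
      (∀ B ∈ {y : realSub (κΓ 𝔸 L c) | ‖incl (κΓ 𝔸 L c) y‖ < εw}, HasFDerivWithinAt
          (fun B : realSub (κΓ 𝔸 L c) => B - (reP (κΓ 𝔸 L c) κΓ_invol ∘L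
            ((hopΓ hL V hε0 hε hW hV hV' hbud c).mkContinuous _ (norm_hopΓ_le hL V hε0 hε hW hV hV' hbud c)).restrictScalars ℝ
            ∘L incl (κ𝔸 𝔸)) (({y : realSub (κΓ 𝔸 L c) | ‖incl (κΓ 𝔸 L c) y‖ < εw}).piecewise
              (fun y => reP (κ𝔸 𝔸) κ𝔸_invol (Dt (incl (κΓ 𝔸 L c) y))) 0 B))
          (ContinuousLinearMap.id ℝ (realSub (κΓ 𝔸 L c)) - (reP (κΓ 𝔸 L c) κΓ_invol ∘L
            ((hopΓ hL V hε0 hε hW hV hV' hbud c).mkContinuous _ (norm_hopΓ_le hL V hε0 hε hW hV hV' hbud c)).restrictScalars ℝ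
            ∘L incl (κ𝔸 𝔸)).comp (reP (κ𝔸 𝔸) κ𝔸_invol ∘L (fderiv ℂ Dt (incl (κΓ 𝔸 L c) B)).restrictScalars ℝ ∘L
              incl (κΓ 𝔸 L c))) {y : realSub (κΓ 𝔸 L c) | ‖incl (κΓ 𝔸 L c) y‖ < εw} B) ∧
      ∀ B ∈ {y : realSub (κΓ 𝔸 L c) | ‖incl (κΓ 𝔸 L c) y‖ < εw},
          (reP (κ𝔸 𝔸) κ𝔸_invol ∘L (fderiv ℂ (QtΓ L V c) 0).restrictScalars ℝ ∘L incl (κΓ 𝔸 L c)) (B - (reP (κΓ 𝔸 L c) κΓ_invol ∘L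
              ((hopΓ hL V hε0 hε hW hV hV' hbud c).mkContinuous _ (norm_hopΓ_le hL V hε0 hε hW hV hV' hbud c)).restrictScalars ℝ
              ∘L incl (κ𝔸 𝔸))
              (({y : realSub (κΓ 𝔸 L c) | ‖incl (κΓ 𝔸 L c) y‖ < εw}).piecewise
                (fun y => reP (κ𝔸 𝔸) κ𝔸_invol (Dt (incl (κΓ 𝔸 L c) y))) 0 B)) +
            (fun y => reP (κ𝔸 𝔸) κ𝔸_invol (nonlin (QtΓ L V c) (incl (κΓ 𝔸 L c) y))) (B - (reP (κΓ 𝔸 L c) κΓ_invol ∘L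
              ((hopΓ hL V hε0 hε hW hV hV' hbud c).mkContinuous _ (norm_hopΓ_le hL V hε0 hε hW hV hV' hbud c)).restrictScalars ℝ
              ∘L incl (κ𝔸 𝔸))
              (({y : realSub (κΓ 𝔸 L c) | ‖incl (κΓ 𝔸 L c) y‖ < εw}).piecewise
                (fun y => reP (κ𝔸 𝔸) κ𝔸_invol (Dt (incl (κΓ 𝔸 L c) y))) 0 B)) = (Ψ.symm B).2 := by
  have hF : HasFDerivAt (QtΓ L V c) (fderiv ℂ (QtΓ L V c) 0) 0 :=
    (hQa 0 (mem_ball_self hR)).differentiableAt.hasFDerivAt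
  exact exists_realForm_chartData_of_Q κ𝔸_invol κΓ_invol hR hQa (QtΓ_zero L V c) hQM hQt
    (fderiv_hopΓ hL V hε0 hε hW hV hV' hbud c hF) (hop_bound_nonneg hL hbud)
    (norm_hopΓ_le hL V hε0 hε hW hV hV' hbud c) (hopΓ_star hL V hε0 hε hW hV hV' hbud c hhop0) hq hRC Ψ hΨ

end Assembly

/-! ## §3b Readable names for the real-form objects of the conclusion (reducible; `rfl`-bridged in file 2) -/

section Names

variable [StarRing 𝔸] [CStarRing 𝔸] [StarModule ℂ 𝔸] {L : ℕ}

/-- the REAL FORM of `DQ̃(0)`: `T := reP ∘ DQ̃(0)↾ℝ ∘ incl : Fix(⋆) → Fix(⋆_𝔸)` (S36∕S40's `L`). [folklore] -/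
abbrev TΓ (L : ℕ) (V : ZdEdge d → 𝔸ˣ) (c : ZdEdge d) : realSub (κΓ 𝔸 L c) →L[ℝ] realSub (κ𝔸 𝔸) :=
  reP (κ𝔸 𝔸) κ𝔸_invol ∘L (fderiv ℂ (QtΓ L V c) 0).restrictScalars ℝ ∘L incl (κΓ 𝔸 L c)

variable (hL : 0 < L) (V : ZdEdge d → 𝔸ˣ) {ε : ℝ} (hε0 : 0 ≤ ε) (hε : ε ≤ 1 / 8)
  (hW : ∀ c', ∀ x ∈ offAxis L c', ‖((loopW L (fun U : ZdEdge d → 𝔸ˣ => gammaT L U) V c' x : 𝔸ˣ) : 𝔸) - 1‖ ≤ ε)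
  (hV : ∀ b, ‖((V b : 𝔸ˣ) : 𝔸)‖ ≤ 1) (hV' : ∀ b, ‖(((V b)⁻¹ : 𝔸ˣ) : 𝔸)‖ ≤ 1)
  (hbud : (L : ℝ) ^ d / L * (24 * ε) < 1)

/-- the REAL FORM of p. 267's `h`: `h := reP ∘ hopΓ↾ℝ ∘ incl : Fix(⋆_𝔸) → Fix(⋆)` (S36∕S40's `h`). [folklore] -/
abbrev hΓ (c : ZdEdge d) : realSub (κ𝔸 𝔸) →L[ℝ] realSub (κΓ 𝔸 L c) :=
  reP (κΓ 𝔸 L c) κΓ_invol ∘L ((hopΓ hL V hε0 hε hW hV hV' hbud c).mkContinuous _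
    (norm_hopΓ_le hL V hε0 hε hW hV hV' hbud c)).restrictScalars ℝ ∘L incl (κ𝔸 𝔸)

/-- the HERMITIAN WINDOW `{y : Fix(⋆) ∣ ‖y‖ < εw}` (S40's real window `{‖incl y‖ < ε}`). [folklore] -/
abbrev winΓ (L : ℕ) (c : ZdEdge d) (εw : ℝ) : Set (realSub (κΓ 𝔸 L c)) := {y | ‖incl (κΓ 𝔸 L c) y‖ < εw}

/-- the REAL `D̃`: `1_window · reP ∘ D̃ ∘ incl` (S36's `D̃_ℝ`). [folklore] -/
abbrev DtΓℝ (L : ℕ) (c : ZdEdge d) (Dt : (↥(qppBonds L c) → 𝔸) → 𝔸) (εw : ℝ) :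
    realSub (κΓ 𝔸 L c) → realSub (κ𝔸 𝔸) :=
  (winΓ L c εw).piecewise (fun y => reP (κ𝔸 𝔸) κ𝔸_invol (Dt (incl (κΓ 𝔸 L c) y))) 0

end Names

end Summit.QuantumFields.BalabanUV.T4Continuum.ShellMeasureLinearizedGammaT

end
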